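import Summits.Ventures.WeilGRH.TwistedMomentDirichletOdd
import HarnessLib

/-!
# Twisted moment certificates (VI): characters with `χ(3) = 0` — the one-ripple format reaches `t = log 2`

Cell `rh-explicit`, WEIL TRACK — GRH ARM (namespace `Summit.Ventures.WeilGRH`).  The twisted moment certificates
(`TwistedMomentCert.lean` / `TwistedMomentCertOdd.lean`) certify `0 ≤ E_{χ,2}(g)` on `C(b)`, where `E_{χ,2}` carries only
the prime `2`; the reduction `Re Q_χ(g) = E_{χ,N}(g)` needs `e^{2t} ≤ N + 1`
(`weilQuadraticChar_re_eq_weilFinitePrimeQuadraticChar`), so with `N = 2` a certificate reaches at most `t = (log 3)/2`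
(`weilPositivityOnChar_of_twistCert`, `…Odd`).  For a character with **`χ(3) = 0`** (e.g. `χ₃ = 3.2`, or any `χ` with
`3 ∣ q`) the `n = 3` spike of the twisted prime ripple vanishes, so `ρ_{χ,3} = ρ_{χ,2}`, `M_{χ,3} = M_{χ,2}` and
`E_{χ,3} = E_{χ,2}` (`weilPrimeRippleChar_three_eq_two_of_chi_three`, `weilFinitePrimeQuadraticChar_three_eq_two_of_chi_three`);
the same one-ripple certificate therefore proves the rung for every `t ≤ b` with `e^{2t} ≤ 4`, i.e. up to **`t = log 2`**
(`weilPositivityOnChar_of_twistCert_of_chi_three`, `…Odd_of_chi_three`; `weilPositivityOnChar_log_two_of_twistCertOdd_of_chi_three`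
with the window test `logTwoHi ≤ b`, `logTwoHi = 0.6931471808 ≥ log 2` via `log_two_half_le_of_check` of `WeilPositivityCertificate.lean`).  Used by the `3.2` certificate at
`a₀ = b = 710/1024 ≥ log 2`.  Everything here is PROVED; no named facts; nothing about zeros of `L(s, χ)`.
-/

noncomputable section

open Complex Finset MeasureTheory Set Filter
open scoped Real Topology ComplexConjugate BigOperators

namespace Summit.Ventures.WeilGRH

open Literature.NumberTheory.LFunctions
open Literature.Analysis.ValidatedNumerics.Numerics

variable {q : ℕ}

/-- For `χ(3) = 0` the `n = 3` spike is absent: `ρ_{χ,3} = ρ_{χ,2}`. [folklore] -/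
theorem weilPrimeRippleChar_three_eq_two_of_chi_three (χ : DirichletCharacter ℂ q)
    (h3 : χ ((3 : ℕ) : ZMod q) = 0) : weilPrimeRippleChar χ 3 = weilPrimeRippleChar χ 2 := by
  have h3' : χ (3 : ZMod q) = 0 := by simpa using h3
  funext τ
  unfold weilPrimeRippleChar
  rw [Finset.sum_range_succ]
  simp [h3']

/-- For `χ(3) = 0`: `M_{χ,3} = M_{χ,2}`. [folklore] -/
theorem weilFinitePrimeWeightChar_three_eq_two_of_chi_three (χ : DirichletCharacter ℂ q)
    (h3 : χ ((3 : ℕ) : ZMod q) = 0) : weilFinitePrimeWeightChar χ 3 = weilFinitePrimeWeightChar χ 2 := by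
  funext τ
  unfold weilFinitePrimeWeightChar
  rw [weilPrimeRippleChar_three_eq_two_of_chi_three χ h3]

/-- For `χ(3) = 0`: `E_{χ,3}(g) = E_{χ,2}(g)`. [folklore] -/
theorem weilFinitePrimeQuadraticChar_three_eq_two_of_chi_three (χ : DirichletCharacter ℂ q)
    (h3 : χ ((3 : ℕ) : ZMod q) = 0) (g : ℝ → ℂ) :
    weilFinitePrimeQuadraticChar χ 3 g = weilFinitePrimeQuadraticChar χ 2 g := by
  unfold weilFinitePrimeQuadraticChar
  rw [weilFinitePrimeWeightChar_three_eq_two_of_chi_three χ h3]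

/-- **The rung from a checked certificate, `χ(3) = 0`**: `WeilPositivityOnChar χ t` for every `t ≤ b` with
`e^{2t} ≤ 4` (`χ` mod `q ≠ 1`, `χ(2) = s`, `χ(3) = 0`). [folklore] -/
theorem weilPositivityOnChar_of_twistCert_of_chi_three (c : TwistCert) {s : ℤ} {p j M : ℕ}
    (hcells : checkCellsZS s p j c.base.wL c.base.T M c.cells = true) (halg : c.checkAlg = true)
    (hq : q ≠ 1) (χ : DirichletCharacter ℂ q) (hχ2 : χ ((2 : ℕ) : ZMod q) = (s : ℂ))
    (hχ3 : χ ((3 : ℕ) : ZMod q) = 0)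
    (hℓ : ((c.ellLo : ℚ) : ℝ) ≤ Real.log q - Real.log π)
    {t : ℝ} (htb : t ≤ (c.b : ℝ)) (ht4 : Real.exp (2 * t) ≤ 4) :
    WeilPositivityOnChar χ t := by
  intro g hg hsupp
  have h4 : Real.exp (2 * t) ≤ ((3 : ℕ) : ℝ) + 1 := by norm_num; exact ht4
  rw [weilQuadraticChar_re_eq_weilFinitePrimeQuadraticChar hq χ hg h4 hsupp,
    weilFinitePrimeQuadraticChar_three_eq_two_of_chi_three χ hχ3]
  exact weilFinitePrimeQuadraticChar_nonneg_of_twistCert c hcells halg χ hχ2 hℓ hg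
    (hsupp.trans (Icc_subset_Icc (by linarith) htb))

/-- **The rung from a checked odd certificate, `χ(3) = 0`**: `WeilPositivityOnChar χ t` for every `t ≤ b` with
`e^{2t} ≤ 4` (`χ` odd mod `q ≠ 1`, `χ(2) = s`, `χ(3) = 0`). [folklore] -/
theorem weilPositivityOnChar_of_twistCertOdd_of_chi_three (c : TwistCertOdd) {s : ℤ} {p j M : ℕ}
    (hcells : checkCellsZS s p j c.cert.base.wL c.cert.base.T M c.cert.cells = true)
    (halg : c.checkAlgOdd = true) (hq : q ≠ 1) (χ : DirichletCharacter ℂ q)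
    (hχ2 : χ ((2 : ℕ) : ZMod q) = (s : ℂ)) (hχ3 : χ ((3 : ℕ) : ZMod q) = 0) (hodd : charParity χ = 1)
    (hℓ : ((c.cert.ellLo : ℚ) : ℝ) ≤ Real.log q - Real.log π)
    {t : ℝ} (htb : t ≤ (c.cert.b : ℝ)) (ht4 : Real.exp (2 * t) ≤ 4) :
    WeilPositivityOnChar χ t := by
  intro g hg hsupp
  have h4 : Real.exp (2 * t) ≤ ((3 : ℕ) : ℝ) + 1 := by norm_num; exact ht4
  rw [weilQuadraticChar_re_eq_weilFinitePrimeQuadraticChar hq χ hg h4 hsupp,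
    weilFinitePrimeQuadraticChar_three_eq_two_of_chi_three χ hχ3]
  exact weilFinitePrimeQuadraticChar_nonneg_of_twistCertOdd c hcells halg χ hχ2 hodd hℓ hg
    (hsupp.trans (Icc_subset_Icc (by linarith) htb))

/-- **The `log 2` rung from a checked certificate, `χ(3) = 0`** (window test `logTwoHi ≤ b`). [folklore] -/
theorem weilPositivityOnChar_log_two_of_twistCert_of_chi_three (c : TwistCert) {s : ℤ} {p j M : ℕ}
    (hcells : checkCellsZS s p j c.base.wL c.base.T M c.cells = true) (halg : c.checkAlg = true)
    (hb : logTwoHi ≤ c.b)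
    (hq : q ≠ 1) (χ : DirichletCharacter ℂ q) (hχ2 : χ ((2 : ℕ) : ZMod q) = (s : ℂ))
    (hχ3 : χ ((3 : ℕ) : ZMod q) = 0) (hℓ : ((c.ellLo : ℚ) : ℝ) ≤ Real.log q - Real.log π) :
    WeilPositivityOnChar χ (Real.log 2) := by
  refine weilPositivityOnChar_of_twistCert_of_chi_three c hcells halg hq χ hχ2 hχ3 hℓ ?_ ?_
  · have h2 : ((logTwoHi : ℚ) : ℝ) ≤ c.b := by exact_mod_cast hb
    have h1 := log_two_half_le_of_check (a0 := logTwoHi / 2) (by rw [mul_div_cancel₀ _ (two_ne_zero)])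
    push_cast at h1
    linarith
  · rw [show 2 * Real.log 2 = Real.log 4 by
      rw [show (4 : ℝ) = 2 ^ 2 by norm_num, Real.log_pow]; push_cast; ring, Real.exp_log (by norm_num)]

/-- **The `log 2` rung from a checked odd certificate, `χ(3) = 0`** (window test `logTwoHi ≤ b`) — used by the
`χ₃ = 3.2` certificate at `a₀ = b = 710/1024`. [folklore] -/
theorem weilPositivityOnChar_log_two_of_twistCertOdd_of_chi_three (c : TwistCertOdd) {s : ℤ} {p j M : ℕ}
    (hcells : checkCellsZS s p j c.cert.base.wL c.cert.base.T M c.cert.cells = true)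
    (halg : c.checkAlgOdd = true) (hb : logTwoHi ≤ c.cert.b)
    (hq : q ≠ 1) (χ : DirichletCharacter ℂ q) (hχ2 : χ ((2 : ℕ) : ZMod q) = (s : ℂ))
    (hχ3 : χ ((3 : ℕ) : ZMod q) = 0) (hodd : charParity χ = 1)
    (hℓ : ((c.cert.ellLo : ℚ) : ℝ) ≤ Real.log q - Real.log π) :
    WeilPositivityOnChar χ (Real.log 2) := by
  refine weilPositivityOnChar_of_twistCertOdd_of_chi_three c hcells halg hq χ hχ2 hχ3 hodd hℓ ?_ ?_
  · have h2 : ((logTwoHi : ℚ) : ℝ) ≤ c.cert.b := by exact_mod_cast hb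
    have h1 := log_two_half_le_of_check (a0 := logTwoHi / 2) (by rw [mul_div_cancel₀ _ (two_ne_zero)])
    push_cast at h1
    linarith
  · rw [show 2 * Real.log 2 = Real.log 4 by
      rw [show (4 : ℝ) = 2 ^ 2 by norm_num, Real.log_pow]; push_cast; ring, Real.exp_log (by norm_num)]

end Summit.Ventures.WeilGRH

end
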